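import Summits.AnomalousDissipation.AnomalousDissipation.Theorems.SolenoidalFractalHomogenisationLagrangianStepVmodFrameDefsJ
import HarnessLib

/-!
# K1L_D (stmt-AnomalousDissipation-27980), (ℓ3-A) road A, (S1) input: EXPLICIT bounds for a pointwise inverse frame `J` (`G J = 1`, `|G − 1| ≤ θ`)
(helper; `--supports 27980 --as helper`; prover ad-k1loc-p3 g11; RULING D28-18 (5): the (S1) N-bound must be explicit in `θ`, uniformly over the
frame class — `IsFrameRegular.derivBound` gives `|∂J|, |∂²J|`, the ZEROTH order `|J| ≤ 2` is derived here from `mul_eq_one` + `near_one`.)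

* `abs_inv_entry_le_two_of_mul_eq_one` — for `3 × 3` real matrices with `G * J = 1` and `|G i j − 1 i j| ≤ θ` entrywise, `θ ≤ 1/18`: `|J a c| ≤ 2`
  (`J = 1 + (1 − G) J`, summed entry sizes `M ≤ 9 + 9θM`);
* `IsFrameRegular.abs_inverse_entry_le_two` — the same along a frame modulation on `[0,Tw]` (and at every real time by `clamped`… stated on the window).
`sorry`-free; NOT a proof of any block, of K1L_D or of AD; rung F-D1.A0.
-/

set_option linter.dupNamespace false

noncomputable section

namespace Summit.AnomalousDissipation.AnomalousDissipation.Theorems.SolenoidalFractalHomogenisation.LagrangianStep.VmodDist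

open Set
open Summit.AnomalousDissipation.AnomalousDissipation.Theorems.SolenoidalFractalHomogenisation.LagrangianStep.CellClauseMod

/-- **Entries of the inverse of a near-identity `3×3` matrix are at most `2`**: `G * J = 1`, `|G − 1| ≤ θ ≤ 1/18` entrywise ⇒ `|J a c| ≤ 2`. -/
theorem abs_inv_entry_le_two_of_mul_eq_one {G J : Matrix (Fin 3) (Fin 3) ℝ} {θ : ℝ} (hGJ : G * J = 1)
    (hG : ∀ i j, |G i j - (1 : Matrix (Fin 3) (Fin 3) ℝ) i j| ≤ θ) (hθ0 : 0 ≤ θ) (hθ : θ ≤ 1 / 18) (a c : Fin 3) : |J a c| ≤ 2 := by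
  -- `J = 1 + (1 − G) J`
  have hJ : ∀ a c, J a c = (1 : Matrix (Fin 3) (Fin 3) ℝ) a c + ∑ b, ((1 : Matrix (Fin 3) (Fin 3) ℝ) a b - G a b) * J b c := by
    intro a c
    have h := congrArg (fun M : Matrix (Fin 3) (Fin 3) ℝ => M a c) hGJ
    simp only [Matrix.mul_apply] at h
    have e : ∑ b, ((1 : Matrix (Fin 3) (Fin 3) ℝ) a b - G a b) * J b c = ∑ b, (1 : Matrix (Fin 3) (Fin 3) ℝ) a b * J b c - ∑ b, G a b * J b c := by
      rw [← Finset.sum_sub_distrib]; exact Finset.sum_congr rfl fun b _ => by ring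
    rw [e, h, ← Matrix.mul_apply, Matrix.one_mul]; ring
  -- entry bound against the total size `M = Σ |J b c|`
  set M : ℝ := ∑ b, ∑ c, |J b c| with hM
  have hM0 : 0 ≤ M := by rw [hM]; positivity
  have hcol : ∀ c, ∑ b, |J b c| ≤ M := fun c => by
    rw [hM, Finset.sum_comm]
    exact Finset.single_le_sum (f := fun c => ∑ b, |J b c|) (fun c _ => by positivity) (Finset.mem_univ c)
  have hentry : ∀ a c, |J a c| ≤ 1 + θ * M := by
    intro a c
    rw [hJ a c]
    refine (abs_add_le _ _).trans (add_le_add ?_ ?_)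
    · rw [Matrix.one_apply]; split_ifs <;> simp
    · refine (Finset.abs_sum_le_sum_abs _ _).trans ?_
      have : ∀ b ∈ (Finset.univ : Finset (Fin 3)), |((1 : Matrix (Fin 3) (Fin 3) ℝ) a b - G a b) * J b c| ≤ θ * |J b c| := fun b _ => by
        rw [abs_mul]
        refine mul_le_mul_of_nonneg_right ?_ (abs_nonneg _)
        rw [abs_sub_comm]; exact hG a b
      refine (Finset.sum_le_sum this).trans ?_
      rw [← Finset.mul_sum]
      exact mul_le_mul_of_nonneg_left (hcol c) hθ0
  -- summing: `M ≤ 9 + 9θM`, so `M ≤ 18`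
  have hMle : M ≤ 9 * (1 + θ * M) := by
    rw [hM]
    calc ∑ b, ∑ c, |J b c| ≤ ∑ b : Fin 3, ∑ c : Fin 3, (1 + θ * M) := Finset.sum_le_sum fun b _ => Finset.sum_le_sum fun c _ => hentry b c
      _ = 9 * (1 + θ * M) := by simp only [Finset.sum_const, Finset.card_univ, Fintype.card_fin, nsmul_eq_mul]; push_cast; ring
  have hM18 : M ≤ 18 := by nlinarith
  calc |J a c| ≤ 1 + θ * M := hentry a c
    _ ≤ 1 + (1 / 18) * 18 := by nlinarith
    _ = 2 := by norm_num

/-- **`|J| ≤ 2` along a frame modulation** (`IsFrameModulation.near_one` + `IsFrameRegular.mul_eq_one`, `θ ≤ 1/18`), on the window `[0,Tw]`. -/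
theorem IsFrameRegular.abs_inverse_entry_le_two {θ Tw nC : ℝ} {G J : ℝ → UnitAddTorus (Fin 3) → Matrix (Fin 3) (Fin 3) ℝ}
    (hR : IsFrameRegular θ Tw nC G J) (hG : IsFrameModulation θ Tw nC G) (hθ : θ ≤ 1 / 18)
    {t : ℝ} (ht : t ∈ Icc 0 Tw) (y : UnitAddTorus (Fin 3)) (a c : Fin 3) : |J t y a c| ≤ 2 := by
  have hθ0 : 0 ≤ θ := le_trans (abs_nonneg _) (hG.near_one t ht y 0 0)
  exact abs_inv_entry_le_two_of_mul_eq_one (hR.mul_eq_one t y) (fun i j => hG.near_one t ht y i j) hθ0 hθ a c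

end Summit.AnomalousDissipation.AnomalousDissipation.Theorems.SolenoidalFractalHomogenisation.LagrangianStep.VmodDist

end
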